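import Mathlib
import HarnessLib
import Literature.Analysis.FluidPDE.VorticityCalculus
import Summits.NavierStokesRegularity.NavierStokesRegularity.Theorems.PoloidalWindowDoorPoloidalWindowRigidityWindow
import Summits.NavierStokesRegularity.NavierStokesRegularity.Theorems.PoloidalWindowDoorPoloidalWindowRigidityFirstIntegral
import Summits.NavierStokesRegularity.NavierStokesRegularity.Theorems.PoloidalWindowDoorPoloidalWindowRigidityLoopTangencyPin
import Summits.NavierStokesRegularity.NavierStokesRegularity.Theorems.PoloidalWindowDoorPoloidalWindowRigidityDiscDichotomy
import Summits.NavierStokesRegularity.NavierStokesRegularity.Theorems.PoloidalWindowDoorPoloidalWindowRigidityHotSplitRidgeReductions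

/-!
# Route `PoloidalWindowDoor`, crux `PoloidalWindowRigidity` (stmt-NavierStokesRegularity-19708) — LINE 15 «hot_split» v1.4.1 (ns-idea-8 g8; critic idea-crit-7 C2a SIZING,
# KEY-NS #182 (2)), part 2: R5 `HotComponentUnbounded` (Šura-Bura in `ℝ³`: every component of the hot set is UNBOUNDED) and the kernels «C2a ⇐ C2a′»,
# «C2b ⇐ C2b′» over R1–R4 of `…HotSplitRidgeReductions`

Cell ns-regularity-ideate, seat ns-poloidal-K2-p2 g13 (K2 hand).  Port to Theorems level of `section RProofs` + the two bookkeeping kernels of the line file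
`Cruxes/PoloidalWindowRigidity/Lines/hot_split.lean` v1.5 (sorry-free there; ns-idea-8 g8), statements VERBATIM with the Cruxes-local `Pinned C v`, `ThickWindow v W`,
`Peakless v` and `hotSet v = {y | y 2 = 0 ∧ v (-1) y 2 = v (-1) 0 2}` unfolded (same convention as A1 p677063 / C1 p686737), proof scripts verbatim over the tree tools
`…Window.isTypeIAncientMild_of_class`, `…LoopTangencyPin.fderiv_eq_zero_of_abs_le` / `apply_integralCurve_eq`, `…DiscDichotomy.eq_const_on_plane_of_analytic`, Mathlib
Picard–Lindelöf.  With these, hot_split's ridge cells C2a / C2b (`stub_cellC2a` / `stub_cellC2b`) are EQUIVALENT to their typed residues C2a′ / C2b′ in the tree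
(`cellC2a_of_ridge`, `cellC2b_of_ridge`); the residues themselves are OPEN research (CENSUS-C2-g8: no lever known).

WHAT THIS IS NOT: no mathematics toward C2a′ / C2b′; the THICK column's residue stays C2a′ ∧ C2b′ ∧ S0 ∧ ⟨27893⟩; 19708 / 20428 OPEN; no claim about Navier–Stokes regularity.
-/

noncomputable section

-- the summit and its single sub-problem share the name (CONVENTIONS §1), as in every Theorems file
set_option linter.dupNamespace false

namespace Summit.NavierStokesRegularity.NavierStokesRegularity.Theorems.PoloidalWindowDoorPoloidalWindowRigidityHotSplitRidgeKernels

open Set Function MeasureTheory Filter Topology Metric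
open scoped InnerProductSpace RealInnerProductSpace Laplacian
open Literature.Analysis Literature.Analysis.FluidPDE
open Summit.NavierStokesRegularity.NavierStokesRegularity.Theorems.PoloidalWindowDoorPoloidalWindowRigidityWindow
open Summit.NavierStokesRegularity.NavierStokesRegularity.Theorems.PoloidalWindowDoorPoloidalWindowRigidityFirstIntegral
open Summit.NavierStokesRegularity.NavierStokesRegularity.Theorems.PoloidalWindowDoorPoloidalWindowRigidityLoopTangencyPin
open Summit.NavierStokesRegularity.NavierStokesRegularity.Theorems.PoloidalWindowDoorPoloidalWindowRigidityDiscDichotomy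
open Summit.NavierStokesRegularity.NavierStokesRegularity.Theorems.PoloidalWindowDoorPoloidalWindowRigidityHotSplitRidgeReductions



/-- Topological core (Šura-Bura in `ℝ³`): a closed set none of whose nonempty compact subsets is relatively clopen has only unbounded components. -/
theorem not_isBounded_connectedComponentIn {H : Set (EuclideanSpace ℝ (Fin 3))} (hH : IsClosed H)
    (hno : ∀ K O : Set (EuclideanSpace ℝ (Fin 3)), IsCompact K → K.Nonempty → K ⊆ H → IsOpen O → K ⊆ O →
      O ∩ H ⊆ K → False)
    {y₀ : EuclideanSpace ℝ (Fin 3)} (hy₀ : y₀ ∈ H) :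
    ¬ Bornology.IsBounded (connectedComponentIn H y₀) := by
  intro hbdd
  -- a ball containing the component
  obtain ⟨R, hR⟩ := (Metric.isBounded_iff_subset_ball (0 : EuclideanSpace ℝ (Fin 3))).1 hbdd
  -- the compact Hausdorff space `X = H ∩ closedBall 0 (R+1)`
  set B : Set (EuclideanSpace ℝ (Fin 3)) := closedBall 0 (R + 1) with hB
  have hXc : IsCompact (H ∩ B) := (isCompact_closedBall _ _).inter_left hH
  haveI : CompactSpace ↥(H ∩ B) := isCompact_iff_compactSpace.1 hXc
  have hy₀S : y₀ ∈ connectedComponentIn H y₀ := mem_connectedComponentIn hy₀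
  have hy₀R : y₀ ∈ ball (0 : EuclideanSpace ℝ (Fin 3)) R := hR hy₀S
  have hy₀B : y₀ ∈ B := by
    rw [hB]; exact mem_closedBall.2 (by have := mem_ball.1 hy₀R; linarith)
  set x₀ : ↥(H ∩ B) := ⟨y₀, hy₀, hy₀B⟩ with hx₀
  -- the component of `x₀` in `X` maps into the component of `y₀` in `H`, hence into `ball 0 R`
  have himg : ((↑) : ↥(H ∩ B) → EuclideanSpace ℝ (Fin 3)) '' connectedComponent x₀ ⊆ connectedComponentIn H y₀ := by
    refine IsPreconnected.subset_connectedComponentIn ?_ ?_ ?_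
    · exact isPreconnected_connectedComponent.image _ continuous_subtype_val.continuousOn
    · exact ⟨x₀, mem_connectedComponent, rfl⟩
    · rintro z ⟨w, -, rfl⟩; exact w.2.1
  -- the open set `U = X ∩ ball 0 (R + 1/2)` contains the component
  set U : Set ↥(H ∩ B) := ((↑) : ↥(H ∩ B) → EuclideanSpace ℝ (Fin 3)) ⁻¹' ball 0 (R + 1/2) with hU
  have hUo : IsOpen U := isOpen_ball.preimage continuous_subtype_val
  have hCU : connectedComponent x₀ ⊆ U := by
    intro w hw
    have : (w : EuclideanSpace ℝ (Fin 3)) ∈ ball (0 : EuclideanSpace ℝ (Fin 3)) R := hR (himg ⟨w, hw, rfl⟩)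
    show (w : EuclideanSpace ℝ (Fin 3)) ∈ ball (0 : EuclideanSpace ℝ (Fin 3)) (R + 1/2)
    exact mem_ball.2 (by have := mem_ball.1 this; linarith)
  -- Šura-Bura: a clopen `W` of `X` with `component ⊆ W ⊆ U`
  have hF : IsCompact Uᶜ := hUo.isClosed_compl.isCompact
  have hinter : Uᶜ ∩ ⋂ Z : {Z : Set ↥(H ∩ B) // IsClopen Z ∧ x₀ ∈ Z}, (Z : Set ↥(H ∩ B)) = ∅ := by
    rw [← connectedComponent_eq_iInter_isClopen x₀]
    ext w; constructor
    · rintro ⟨hwU, hwC⟩; exact hwU (hCU hwC)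
    · intro h; exact h.elim
  obtain ⟨t, ht⟩ := hF.elim_finite_subfamily_closed
    (fun Z : {Z : Set ↥(H ∩ B) // IsClopen Z ∧ x₀ ∈ Z} => (Z : Set ↥(H ∩ B))) (fun Z => Z.2.1.1) hinter
  set W : Set ↥(H ∩ B) := ⋂ Z ∈ t, (Z : Set ↥(H ∩ B)) with hW
  have hWclopen : IsClopen W := isClopen_biInter_finset (fun Z _ => Z.2.1)
  have hx₀W : x₀ ∈ W := by
    rw [hW]; exact mem_iInter₂.2 (fun Z _ => Z.2.2)
  have hWU : W ⊆ U := by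
    intro w hw
    by_contra hwU
    have : w ∈ Uᶜ ∩ ⋂ Z ∈ t, (Z : Set ↥(H ∩ B)) := ⟨hwU, hw⟩
    rw [ht] at this; exact this
  -- transport to `ℝ³`
  obtain ⟨O₁, hO₁, hO₁W⟩ := isOpen_induced_iff.1 hWclopen.isOpen
  set K : Set (EuclideanSpace ℝ (Fin 3)) := ((↑) : ↥(H ∩ B) → EuclideanSpace ℝ (Fin 3)) '' W with hK
  have hKc : IsCompact K := hWclopen.isClosed.isCompact.image continuous_subtype_val
  have hKne : K.Nonempty := ⟨y₀, ⟨x₀, hx₀W, rfl⟩⟩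
  have hKH : K ⊆ H := by rintro z ⟨w, -, rfl⟩; exact w.2.1
  refine hno K (O₁ ∩ ball 0 (R + 1/2)) hKc hKne hKH (hO₁.inter isOpen_ball) ?_ ?_
  · rintro z ⟨w, hw, rfl⟩
    refine ⟨?_, hWU hw⟩
    have : w ∈ ((↑) : ↥(H ∩ B) → EuclideanSpace ℝ (Fin 3)) ⁻¹' O₁ := by rw [hO₁W]; exact hw
    exact this
  · rintro z ⟨⟨hzO, hzball⟩, hzH⟩
    have hzB : z ∈ B := by
      rw [hB]; exact mem_closedBall.2 (by have := mem_ball.1 hzball; linarith)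
    refine ⟨⟨z, hzH, hzB⟩, ?_, rfl⟩
    have : (⟨z, hzH, hzB⟩ : ↥(H ∩ B)) ∈ ((↑) : ↥(H ∩ B) → EuclideanSpace ℝ (Fin 3)) ⁻¹' O₁ := hzO
    rw [hO₁W] at this; exact this

/-- **R5 — PROVED (v1.5): in the pinned peakless class every connected component of the hot set `H ⊂ P₀` is UNBOUNDED.**  This is the typed
content the tree's `…HotLoopsPeakless` (conditional on the wall) explicitly did NOT claim («every component of `Hot` is unbounded»); here it is
unconditional inside HL3′ (hypothesis `Peakless`, no wall), from R1 (closed) + R3 (no compact relatively-clopen piece) + Šura-Bura.  Consequence for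
the residues: the hot ridge of C2a′ / C2b′ through the hot spot REACHES INFINITY — the «bounded, accumulating» alternative of the census is dead. -/
theorem hotComponent_unbounded :
    ∀ (C : ℝ) (v : ℝ → EuclideanSpace ℝ (Fin 3) → EuclideanSpace ℝ (Fin 3)), (Literature.Analysis.FluidPDE.HasTypeITimeDecay C v ∧
        ContinuousOn (Function.uncurry v) (Set.Iio (0 : ℝ) ×ˢ Set.univ) ∧
        (∀ s t : ℝ, s < t → t < 0 → ∀ x, v t x =
          Literature.Analysis.UnboundedOperators.heatExtension (v s) (t - s) x -
            Literature.Analysis.FluidPDE.oseenDuhamel 1 s v v t x) ∧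
        (∀ t < 0, Literature.Analysis.FluidPDE.VectorCalculus.IsDivFree (v t)) ∧
        (∀ s < 0, ∀ y, ⟪Literature.Analysis.FluidPDE.curl (v s) y, EuclideanSpace.single 2 1⟫_ℝ = 0) ∧
        v (-1) 0 2 ≠ 0 ∧ (∀ t < 0, ∀ x, Real.sqrt (-t) * |v t x 2| ≤ |v (-1) 0 2|) ∧
        (∀ h : EuclideanSpace ℝ (Fin 3), fderiv ℝ (v (-1)) 0 h 2 = 0) ∧
        (deriv (fun s => v s 0 2) (-1) = v (-1) 0 2 / 2 ∧ v (-1) 0 2 * (Δ (fun y => v (-1) y 2)) 0 ≤ 0)) → (∀ (s z₀ σ M : ℝ) (K O : Set (EuclideanSpace ℝ (Fin 3))), s < 0 →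
        ((σ = 1 ∨ σ = -1) ∧ IsCompact K ∧ K.Nonempty ∧ (∀ y ∈ K, y 2 = z₀ ∧ σ * v s y 2 = M) ∧
          IsOpen O ∧ K ⊆ O ∧ (∀ y ∈ O, y 2 = z₀ → σ * v s y 2 ≤ M) ∧
          (∀ y ∈ O, y 2 = z₀ → σ * v s y 2 = M → y ∈ K)) → False) →
    ∀ y ∈ {y : EuclideanSpace ℝ (Fin 3) | y 2 = 0 ∧ v (-1) y 2 = v (-1) 0 2}, ¬ Bornology.IsBounded (connectedComponentIn {y : EuclideanSpace ℝ (Fin 3) | y 2 = 0 ∧ v (-1) y 2 = v (-1) 0 2} y) := by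
  intro C v hP hPk y hy
  exact not_isBounded_connectedComponentIn (hotSetClosedCritical C v hP).1 (noCompactIsolatedHotPiece C v hP hPk) hy

/-- In particular the component of the HOT SPOT `0 ∈ H` is unbounded: `H` contains an unbounded connected closed set through `0`. -/
theorem hotSpot_component_unbounded {C : ℝ} {v : ℝ → EuclideanSpace ℝ (Fin 3) → EuclideanSpace ℝ (Fin 3)}
    (hP : (Literature.Analysis.FluidPDE.HasTypeITimeDecay C v ∧
        ContinuousOn (Function.uncurry v) (Set.Iio (0 : ℝ) ×ˢ Set.univ) ∧
        (∀ s t : ℝ, s < t → t < 0 → ∀ x, v t x =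
          Literature.Analysis.UnboundedOperators.heatExtension (v s) (t - s) x -
            Literature.Analysis.FluidPDE.oseenDuhamel 1 s v v t x) ∧
        (∀ t < 0, Literature.Analysis.FluidPDE.VectorCalculus.IsDivFree (v t)) ∧
        (∀ s < 0, ∀ y, ⟪Literature.Analysis.FluidPDE.curl (v s) y, EuclideanSpace.single 2 1⟫_ℝ = 0) ∧
        v (-1) 0 2 ≠ 0 ∧ (∀ t < 0, ∀ x, Real.sqrt (-t) * |v t x 2| ≤ |v (-1) 0 2|) ∧
        (∀ h : EuclideanSpace ℝ (Fin 3), fderiv ℝ (v (-1)) 0 h 2 = 0) ∧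
        (deriv (fun s => v s 0 2) (-1) = v (-1) 0 2 / 2 ∧ v (-1) 0 2 * (Δ (fun y => v (-1) y 2)) 0 ≤ 0)))
    (hPk : (∀ (s z₀ σ M : ℝ) (K O : Set (EuclideanSpace ℝ (Fin 3))), s < 0 →
        ((σ = 1 ∨ σ = -1) ∧ IsCompact K ∧ K.Nonempty ∧ (∀ y ∈ K, y 2 = z₀ ∧ σ * v s y 2 = M) ∧
          IsOpen O ∧ K ⊆ O ∧ (∀ y ∈ O, y 2 = z₀ → σ * v s y 2 ≤ M) ∧
          (∀ y ∈ O, y 2 = z₀ → σ * v s y 2 = M → y ∈ K)) → False)) :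
    ¬ Bornology.IsBounded (connectedComponentIn ({y : EuclideanSpace ℝ (Fin 3) | y 2 = 0 ∧ v (-1) y 2 = v (-1) 0 2}) 0) :=
  hotComponent_unbounded C v hP hPk 0 ⟨rfl, rfl⟩




/-- **KERNEL `cellC2a_of_ridge : C2a′ → C2a`** — hot_split's cell C2a (`stub_cellC2a`, VERBATIM unfolded) follows from its residue C2a′ (`stub_cellC2aRidge`,
VERBATIM unfolded), R1–R4 being discharged by the theorems above. -/
theorem cellC2a_of_ridge
    (hres : ∀ (C : ℝ) (v : ℝ → EuclideanSpace ℝ (Fin 3) → EuclideanSpace ℝ (Fin 3)) (W : Set (ℝ × EuclideanSpace ℝ (Fin 3))),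
      (Literature.Analysis.FluidPDE.HasTypeITimeDecay C v ∧
        ContinuousOn (Function.uncurry v) (Set.Iio (0 : ℝ) ×ˢ Set.univ) ∧
        (∀ s t : ℝ, s < t → t < 0 → ∀ x, v t x =
          Literature.Analysis.UnboundedOperators.heatExtension (v s) (t - s) x -
            Literature.Analysis.FluidPDE.oseenDuhamel 1 s v v t x) ∧
        (∀ t < 0, Literature.Analysis.FluidPDE.VectorCalculus.IsDivFree (v t)) ∧
        (∀ s < 0, ∀ y, ⟪Literature.Analysis.FluidPDE.curl (v s) y, EuclideanSpace.single 2 1⟫_ℝ = 0) ∧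
        v (-1) 0 2 ≠ 0 ∧ (∀ t < 0, ∀ x, Real.sqrt (-t) * |v t x 2| ≤ |v (-1) 0 2|) ∧
        (∀ h : EuclideanSpace ℝ (Fin 3), fderiv ℝ (v (-1)) 0 h 2 = 0) ∧
        (deriv (fun s => v s 0 2) (-1) = v (-1) 0 2 / 2 ∧ v (-1) 0 2 * (Δ (fun y => v (-1) y 2)) 0 ≤ 0)) →
      (IsOpen W ∧ W ⊆ Set.Iio (0 : ℝ) ×ˢ Set.univ ∧
        (∀ z ∈ W, (Literature.Analysis.FluidPDE.curl (v z.1) z.2 ≠ 0 ∧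
            (fderiv ℝ (v z.1) z.2 (EuclideanSpace.single 0 1) 2 ≠ 0 ∨ fderiv ℝ (v z.1) z.2 (EuclideanSpace.single 1 1) 2 ≠ 0) ∧
            (fderiv ℝ (v z.1) z.2 (EuclideanSpace.single 2 1) 0 ≠ 0 ∨ fderiv ℝ (v z.1) z.2 (EuclideanSpace.single 2 1) 1 ≠ 0)) ∧
          (fderiv ℝ (fun x => fderiv ℝ (v z.1) x (EuclideanSpace.single 2 1) 2) z.2 (EuclideanSpace.single 0 1) *
                fderiv ℝ (v z.1) z.2 (EuclideanSpace.single 1 1) 2 -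
              fderiv ℝ (fun x => fderiv ℝ (v z.1) x (EuclideanSpace.single 2 1) 2) z.2 (EuclideanSpace.single 1 1) *
                fderiv ℝ (v z.1) z.2 (EuclideanSpace.single 0 1) 2 ≠ 0)) ∧
        (∀ m : ℝ → ℝ → ℝ, ∀ W₁ : Set (ℝ × EuclideanSpace ℝ (Fin 3)), W₁ ⊆ W → IsOpen W₁ → W₁.Nonempty →
            ∃ z ∈ W₁, ∃ b : Fin 3, b ≠ 2 ∧
              fderiv ℝ (v z.1) z.2 (EuclideanSpace.single 2 1) b ≠
                m z.1 (z.2 2) * fderiv ℝ (v z.1) z.2 (EuclideanSpace.single b 1) 2) ∧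
        (∀ r : ℝ, 0 < r → (Metric.ball ((-1 : ℝ), (0 : EuclideanSpace ℝ (Fin 3))) r ∩ W).Nonempty)) →
      (∀ (s z₀ σ M : ℝ) (K O : Set (EuclideanSpace ℝ (Fin 3))), s < 0 →
        ((σ = 1 ∨ σ = -1) ∧ IsCompact K ∧ K.Nonempty ∧ (∀ y ∈ K, y 2 = z₀ ∧ σ * v s y 2 = M) ∧
          IsOpen O ∧ K ⊆ O ∧ (∀ y ∈ O, y 2 = z₀ → σ * v s y 2 ≤ M) ∧
          (∀ y ∈ O, y 2 = z₀ → σ * v s y 2 = M → y ∈ K)) → False) →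
      (∀ s < 0, ∀ y, ⟪fderiv ℝ (v s) y (Literature.Analysis.FluidPDE.curl (v s) y), EuclideanSpace.single 2 1⟫_ℝ = 0) →
      IsClosed ({y : EuclideanSpace ℝ (Fin 3) | y 2 = 0 ∧ v (-1) y 2 = v (-1) 0 2}) → (∀ y ∈ {y : EuclideanSpace ℝ (Fin 3) | y 2 = 0 ∧ v (-1) y 2 = v (-1) 0 2}, fderiv ℝ (fun x => v (-1) x 2) y = 0) →
      (∀ K O : Set (EuclideanSpace ℝ (Fin 3)), IsCompact K → K.Nonempty → K ⊆ {y : EuclideanSpace ℝ (Fin 3) | y 2 = 0 ∧ v (-1) y 2 = v (-1) 0 2} → IsOpen O → K ⊆ O →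
        O ∩ {y : EuclideanSpace ℝ (Fin 3) | y 2 = 0 ∧ v (-1) y 2 = v (-1) 0 2} ⊆ K → False) →
      (∀ y ∈ {y : EuclideanSpace ℝ (Fin 3) | y 2 = 0 ∧ v (-1) y 2 = v (-1) 0 2}, ∀ r : ℝ, 0 < r →
        ∃ y' : EuclideanSpace ℝ (Fin 3), y' 2 = 0 ∧ dist y' y < r ∧ v (-1) y' 2 ≠ v (-1) 0 2) →
      (∃ (γ : ℝ → EuclideanSpace ℝ (Fin 3)) (ε : ℝ), 0 < ε ∧ γ 0 ∈ {y : EuclideanSpace ℝ (Fin 3) | y 2 = 0 ∧ v (-1) y 2 = v (-1) 0 2} ∧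
        Literature.Analysis.FluidPDE.curl (v (-1)) (γ 0) ≠ 0 ∧
        ∀ τ ∈ Set.Ioo (-ε) ε, HasDerivAt γ (Literature.Analysis.FluidPDE.curl (v (-1)) (γ τ)) τ ∧ γ τ ∈ {y : EuclideanSpace ℝ (Fin 3) | y 2 = 0 ∧ v (-1) y 2 = v (-1) 0 2}) →
      False) :
    ∀ (C : ℝ) (v : ℝ → EuclideanSpace ℝ (Fin 3) → EuclideanSpace ℝ (Fin 3)) (W : Set (ℝ × EuclideanSpace ℝ (Fin 3))),
      (Literature.Analysis.FluidPDE.HasTypeITimeDecay C v ∧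
        ContinuousOn (Function.uncurry v) (Set.Iio (0 : ℝ) ×ˢ Set.univ) ∧
        (∀ s t : ℝ, s < t → t < 0 → ∀ x, v t x =
          Literature.Analysis.UnboundedOperators.heatExtension (v s) (t - s) x -
            Literature.Analysis.FluidPDE.oseenDuhamel 1 s v v t x) ∧
        (∀ t < 0, Literature.Analysis.FluidPDE.VectorCalculus.IsDivFree (v t)) ∧
        (∀ s < 0, ∀ y, ⟪Literature.Analysis.FluidPDE.curl (v s) y, EuclideanSpace.single 2 1⟫_ℝ = 0) ∧
        v (-1) 0 2 ≠ 0 ∧ (∀ t < 0, ∀ x, Real.sqrt (-t) * |v t x 2| ≤ |v (-1) 0 2|) ∧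
        (∀ h : EuclideanSpace ℝ (Fin 3), fderiv ℝ (v (-1)) 0 h 2 = 0) ∧
        (deriv (fun s => v s 0 2) (-1) = v (-1) 0 2 / 2 ∧ v (-1) 0 2 * (Δ (fun y => v (-1) y 2)) 0 ≤ 0)) →
      (IsOpen W ∧ W ⊆ Set.Iio (0 : ℝ) ×ˢ Set.univ ∧
        (∀ z ∈ W, (Literature.Analysis.FluidPDE.curl (v z.1) z.2 ≠ 0 ∧
            (fderiv ℝ (v z.1) z.2 (EuclideanSpace.single 0 1) 2 ≠ 0 ∨ fderiv ℝ (v z.1) z.2 (EuclideanSpace.single 1 1) 2 ≠ 0) ∧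
            (fderiv ℝ (v z.1) z.2 (EuclideanSpace.single 2 1) 0 ≠ 0 ∨ fderiv ℝ (v z.1) z.2 (EuclideanSpace.single 2 1) 1 ≠ 0)) ∧
          (fderiv ℝ (fun x => fderiv ℝ (v z.1) x (EuclideanSpace.single 2 1) 2) z.2 (EuclideanSpace.single 0 1) *
                fderiv ℝ (v z.1) z.2 (EuclideanSpace.single 1 1) 2 -
              fderiv ℝ (fun x => fderiv ℝ (v z.1) x (EuclideanSpace.single 2 1) 2) z.2 (EuclideanSpace.single 1 1) *
                fderiv ℝ (v z.1) z.2 (EuclideanSpace.single 0 1) 2 ≠ 0)) ∧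
        (∀ m : ℝ → ℝ → ℝ, ∀ W₁ : Set (ℝ × EuclideanSpace ℝ (Fin 3)), W₁ ⊆ W → IsOpen W₁ → W₁.Nonempty →
            ∃ z ∈ W₁, ∃ b : Fin 3, b ≠ 2 ∧
              fderiv ℝ (v z.1) z.2 (EuclideanSpace.single 2 1) b ≠
                m z.1 (z.2 2) * fderiv ℝ (v z.1) z.2 (EuclideanSpace.single b 1) 2) ∧
        (∀ r : ℝ, 0 < r → (Metric.ball ((-1 : ℝ), (0 : EuclideanSpace ℝ (Fin 3))) r ∩ W).Nonempty)) →
      (∀ (s z₀ σ M : ℝ) (K O : Set (EuclideanSpace ℝ (Fin 3))), s < 0 →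
        ((σ = 1 ∨ σ = -1) ∧ IsCompact K ∧ K.Nonempty ∧ (∀ y ∈ K, y 2 = z₀ ∧ σ * v s y 2 = M) ∧
          IsOpen O ∧ K ⊆ O ∧ (∀ y ∈ O, y 2 = z₀ → σ * v s y 2 ≤ M) ∧
          (∀ y ∈ O, y 2 = z₀ → σ * v s y 2 = M → y ∈ K)) → False) →
      (∃ y : EuclideanSpace ℝ (Fin 3), y 2 = 0 ∧ v (-1) y 2 ≠ v (-1) 0 2) →
      (∀ s < 0, ∀ y, ⟪fderiv ℝ (v s) y (Literature.Analysis.FluidPDE.curl (v s) y), EuclideanSpace.single 2 1⟫_ℝ = 0) →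
      (∃ y : EuclideanSpace ℝ (Fin 3), y 2 = 0 ∧ v (-1) y 2 = v (-1) 0 2 ∧
        Literature.Analysis.FluidPDE.curl (v (-1)) y ≠ 0) →
      False := by
  intro C v W hP hTW hPk hnon hFL hhot
  obtain ⟨y₀, hy₀0, hy₀N, hω⟩ := hhot
  have hy₀H : y₀ ∈ {y : EuclideanSpace ℝ (Fin 3) | y 2 = 0 ∧ v (-1) y 2 = v (-1) 0 2} := ⟨hy₀0, hy₀N⟩
  obtain ⟨hcl, hcrit⟩ := hotSetClosedCritical C v hP
  obtain ⟨γ, ε, hε, hγ0, hγ⟩ := vortexLineHot C v hP hFL y₀ hy₀H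
  refine hres C v W hP hTW hPk hFL hcl hcrit (noCompactIsolatedHotPiece C v hP hPk) (hotSetNoInterior C v hP hnon) ⟨γ, ε, hε, ?_, ?_, hγ⟩
  · rw [hγ0]; exact hy₀H
  · rw [hγ0]; exact hω

/-- **KERNEL `cellC2b_of_ridge : C2b′ → C2b`** — the same for the null-ridge cell. -/
theorem cellC2b_of_ridge
    (hres : ∀ (C : ℝ) (v : ℝ → EuclideanSpace ℝ (Fin 3) → EuclideanSpace ℝ (Fin 3)) (W : Set (ℝ × EuclideanSpace ℝ (Fin 3))),
      (Literature.Analysis.FluidPDE.HasTypeITimeDecay C v ∧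
        ContinuousOn (Function.uncurry v) (Set.Iio (0 : ℝ) ×ˢ Set.univ) ∧
        (∀ s t : ℝ, s < t → t < 0 → ∀ x, v t x =
          Literature.Analysis.UnboundedOperators.heatExtension (v s) (t - s) x -
            Literature.Analysis.FluidPDE.oseenDuhamel 1 s v v t x) ∧
        (∀ t < 0, Literature.Analysis.FluidPDE.VectorCalculus.IsDivFree (v t)) ∧
        (∀ s < 0, ∀ y, ⟪Literature.Analysis.FluidPDE.curl (v s) y, EuclideanSpace.single 2 1⟫_ℝ = 0) ∧
        v (-1) 0 2 ≠ 0 ∧ (∀ t < 0, ∀ x, Real.sqrt (-t) * |v t x 2| ≤ |v (-1) 0 2|) ∧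
        (∀ h : EuclideanSpace ℝ (Fin 3), fderiv ℝ (v (-1)) 0 h 2 = 0) ∧
        (deriv (fun s => v s 0 2) (-1) = v (-1) 0 2 / 2 ∧ v (-1) 0 2 * (Δ (fun y => v (-1) y 2)) 0 ≤ 0)) →
      (IsOpen W ∧ W ⊆ Set.Iio (0 : ℝ) ×ˢ Set.univ ∧
        (∀ z ∈ W, (Literature.Analysis.FluidPDE.curl (v z.1) z.2 ≠ 0 ∧
            (fderiv ℝ (v z.1) z.2 (EuclideanSpace.single 0 1) 2 ≠ 0 ∨ fderiv ℝ (v z.1) z.2 (EuclideanSpace.single 1 1) 2 ≠ 0) ∧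
            (fderiv ℝ (v z.1) z.2 (EuclideanSpace.single 2 1) 0 ≠ 0 ∨ fderiv ℝ (v z.1) z.2 (EuclideanSpace.single 2 1) 1 ≠ 0)) ∧
          (fderiv ℝ (fun x => fderiv ℝ (v z.1) x (EuclideanSpace.single 2 1) 2) z.2 (EuclideanSpace.single 0 1) *
                fderiv ℝ (v z.1) z.2 (EuclideanSpace.single 1 1) 2 -
              fderiv ℝ (fun x => fderiv ℝ (v z.1) x (EuclideanSpace.single 2 1) 2) z.2 (EuclideanSpace.single 1 1) *
                fderiv ℝ (v z.1) z.2 (EuclideanSpace.single 0 1) 2 ≠ 0)) ∧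
        (∀ m : ℝ → ℝ → ℝ, ∀ W₁ : Set (ℝ × EuclideanSpace ℝ (Fin 3)), W₁ ⊆ W → IsOpen W₁ → W₁.Nonempty →
            ∃ z ∈ W₁, ∃ b : Fin 3, b ≠ 2 ∧
              fderiv ℝ (v z.1) z.2 (EuclideanSpace.single 2 1) b ≠
                m z.1 (z.2 2) * fderiv ℝ (v z.1) z.2 (EuclideanSpace.single b 1) 2) ∧
        (∀ r : ℝ, 0 < r → (Metric.ball ((-1 : ℝ), (0 : EuclideanSpace ℝ (Fin 3))) r ∩ W).Nonempty)) →
      (∀ (s z₀ σ M : ℝ) (K O : Set (EuclideanSpace ℝ (Fin 3))), s < 0 →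
        ((σ = 1 ∨ σ = -1) ∧ IsCompact K ∧ K.Nonempty ∧ (∀ y ∈ K, y 2 = z₀ ∧ σ * v s y 2 = M) ∧
          IsOpen O ∧ K ⊆ O ∧ (∀ y ∈ O, y 2 = z₀ → σ * v s y 2 ≤ M) ∧
          (∀ y ∈ O, y 2 = z₀ → σ * v s y 2 = M → y ∈ K)) → False) →
      (∀ s < 0, ∀ y, ⟪fderiv ℝ (v s) y (Literature.Analysis.FluidPDE.curl (v s) y), EuclideanSpace.single 2 1⟫_ℝ = 0) →
      IsClosed ({y : EuclideanSpace ℝ (Fin 3) | y 2 = 0 ∧ v (-1) y 2 = v (-1) 0 2}) → (∀ y ∈ {y : EuclideanSpace ℝ (Fin 3) | y 2 = 0 ∧ v (-1) y 2 = v (-1) 0 2}, fderiv ℝ (fun x => v (-1) x 2) y = 0) →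
      (∀ K O : Set (EuclideanSpace ℝ (Fin 3)), IsCompact K → K.Nonempty → K ⊆ {y : EuclideanSpace ℝ (Fin 3) | y 2 = 0 ∧ v (-1) y 2 = v (-1) 0 2} → IsOpen O → K ⊆ O →
        O ∩ {y : EuclideanSpace ℝ (Fin 3) | y 2 = 0 ∧ v (-1) y 2 = v (-1) 0 2} ⊆ K → False) →
      (∀ y ∈ {y : EuclideanSpace ℝ (Fin 3) | y 2 = 0 ∧ v (-1) y 2 = v (-1) 0 2}, ∀ r : ℝ, 0 < r →
        ∃ y' : EuclideanSpace ℝ (Fin 3), y' 2 = 0 ∧ dist y' y < r ∧ v (-1) y' 2 ≠ v (-1) 0 2) →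
      (∀ y ∈ {y : EuclideanSpace ℝ (Fin 3) | y 2 = 0 ∧ v (-1) y 2 = v (-1) 0 2}, Literature.Analysis.FluidPDE.curl (v (-1)) y = 0) →
      False) :
    ∀ (C : ℝ) (v : ℝ → EuclideanSpace ℝ (Fin 3) → EuclideanSpace ℝ (Fin 3)) (W : Set (ℝ × EuclideanSpace ℝ (Fin 3))),
      (Literature.Analysis.FluidPDE.HasTypeITimeDecay C v ∧
        ContinuousOn (Function.uncurry v) (Set.Iio (0 : ℝ) ×ˢ Set.univ) ∧
        (∀ s t : ℝ, s < t → t < 0 → ∀ x, v t x =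
          Literature.Analysis.UnboundedOperators.heatExtension (v s) (t - s) x -
            Literature.Analysis.FluidPDE.oseenDuhamel 1 s v v t x) ∧
        (∀ t < 0, Literature.Analysis.FluidPDE.VectorCalculus.IsDivFree (v t)) ∧
        (∀ s < 0, ∀ y, ⟪Literature.Analysis.FluidPDE.curl (v s) y, EuclideanSpace.single 2 1⟫_ℝ = 0) ∧
        v (-1) 0 2 ≠ 0 ∧ (∀ t < 0, ∀ x, Real.sqrt (-t) * |v t x 2| ≤ |v (-1) 0 2|) ∧
        (∀ h : EuclideanSpace ℝ (Fin 3), fderiv ℝ (v (-1)) 0 h 2 = 0) ∧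
        (deriv (fun s => v s 0 2) (-1) = v (-1) 0 2 / 2 ∧ v (-1) 0 2 * (Δ (fun y => v (-1) y 2)) 0 ≤ 0)) →
      (IsOpen W ∧ W ⊆ Set.Iio (0 : ℝ) ×ˢ Set.univ ∧
        (∀ z ∈ W, (Literature.Analysis.FluidPDE.curl (v z.1) z.2 ≠ 0 ∧
            (fderiv ℝ (v z.1) z.2 (EuclideanSpace.single 0 1) 2 ≠ 0 ∨ fderiv ℝ (v z.1) z.2 (EuclideanSpace.single 1 1) 2 ≠ 0) ∧
            (fderiv ℝ (v z.1) z.2 (EuclideanSpace.single 2 1) 0 ≠ 0 ∨ fderiv ℝ (v z.1) z.2 (EuclideanSpace.single 2 1) 1 ≠ 0)) ∧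
          (fderiv ℝ (fun x => fderiv ℝ (v z.1) x (EuclideanSpace.single 2 1) 2) z.2 (EuclideanSpace.single 0 1) *
                fderiv ℝ (v z.1) z.2 (EuclideanSpace.single 1 1) 2 -
              fderiv ℝ (fun x => fderiv ℝ (v z.1) x (EuclideanSpace.single 2 1) 2) z.2 (EuclideanSpace.single 1 1) *
                fderiv ℝ (v z.1) z.2 (EuclideanSpace.single 0 1) 2 ≠ 0)) ∧
        (∀ m : ℝ → ℝ → ℝ, ∀ W₁ : Set (ℝ × EuclideanSpace ℝ (Fin 3)), W₁ ⊆ W → IsOpen W₁ → W₁.Nonempty →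
            ∃ z ∈ W₁, ∃ b : Fin 3, b ≠ 2 ∧
              fderiv ℝ (v z.1) z.2 (EuclideanSpace.single 2 1) b ≠
                m z.1 (z.2 2) * fderiv ℝ (v z.1) z.2 (EuclideanSpace.single b 1) 2) ∧
        (∀ r : ℝ, 0 < r → (Metric.ball ((-1 : ℝ), (0 : EuclideanSpace ℝ (Fin 3))) r ∩ W).Nonempty)) →
      (∀ (s z₀ σ M : ℝ) (K O : Set (EuclideanSpace ℝ (Fin 3))), s < 0 →
        ((σ = 1 ∨ σ = -1) ∧ IsCompact K ∧ K.Nonempty ∧ (∀ y ∈ K, y 2 = z₀ ∧ σ * v s y 2 = M) ∧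
          IsOpen O ∧ K ⊆ O ∧ (∀ y ∈ O, y 2 = z₀ → σ * v s y 2 ≤ M) ∧
          (∀ y ∈ O, y 2 = z₀ → σ * v s y 2 = M → y ∈ K)) → False) →
      (∃ y : EuclideanSpace ℝ (Fin 3), y 2 = 0 ∧ v (-1) y 2 ≠ v (-1) 0 2) →
      (∀ s < 0, ∀ y, ⟪fderiv ℝ (v s) y (Literature.Analysis.FluidPDE.curl (v s) y), EuclideanSpace.single 2 1⟫_ℝ = 0) →
      (∀ y : EuclideanSpace ℝ (Fin 3), y 2 = 0 → v (-1) y 2 = v (-1) 0 2 →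
        Literature.Analysis.FluidPDE.curl (v (-1)) y = 0) →
      False := by
  intro C v W hP hTW hPk hnon hFL hnull
  obtain ⟨hcl, hcrit⟩ := hotSetClosedCritical C v hP
  exact hres C v W hP hTW hPk hFL hcl hcrit (noCompactIsolatedHotPiece C v hP hPk) (hotSetNoInterior C v hP hnon) (fun y hy => hnull y hy.1 hy.2)

end Summit.NavierStokesRegularity.NavierStokesRegularity.Theorems.PoloidalWindowDoorPoloidalWindowRigidityHotSplitRidgeKernels

end
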